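import Summits.QuantumFields.YangMills.Theorems.BalabanUVNodesPortS1FHInterface
import Literature.MathematicalPhysics.QuantumFieldTheory.Balaban1983to89.B13Contraction113
import Literature.MathematicalPhysics.QuantumFieldTheory.Balaban1983to89.B12Lineariz267
import Literature.MathematicalPhysics.QuantumFieldTheory.Balaban1983to89.B12LinearizAnalytic267

/-!
# NODE O port — F_H DISCHARGED BY CITATION over the contraction-grade interface 𝔅⁺
# (`BoundsC`; `fh1Exists_of_boundsC`, `fh2Exists_of_boundsC`, `fhClosed_of_boundsC`, `fh12_on_sPolydisc`) — record-free, ADDITIVE to ✓`…PortS1FHInterface`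

Source: ◇ lens-1 g18 (cell `ym-nodeO-ideate`) edition v25, cell scratch `nodeO-cover/LENS1g18FHDischarge.lean` §B–§F + §E′ (memo
`nodeO-cover/LENS-1-NODE-v25-FH-DISCHARGE.md`); docket ★★★ director-ym №656; lane `--supports stmt-QuantumFields-27930 --as helper`.
[II] = [Balaban1988RG2Cluster], [15] = [Balaban1985Variational], [I] = [Balaban1987RG1], [13] = [Balaban1985BackgroundPropagators].

WHAT THIS FILE PROVES.  The interface of record ✓`…PortS1FHInterface` files F_H-1∕F_H-2 — EXISTENCE + ANALYTICITY of the fixed points `D` of (1.3) and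
`A₀` of (1.4), with (1.14)∕(1.16) — as bare Props `FH1Exists`, `FH2Exists`.  They are theorems BY CITATION of landed Literature under the right interface
GRADE: print's «We prove similarly that it is contractive on this domain, hence the fixed point is an analytic function of A′» ([II] p.5) is [15] (53)–(54)
transplanted, and the tree kernel-checks that scheme over abstract complex Banach spaces —
* ✓`B13Contraction113`: `QuadAnalytic C C₂ R`, the self-map `mapsTo_T`, the Lipschitz bound `lipschitz_T` (constant `9C₂bε`, `C` evaluated on `|Z| < 3ε`),
  `exists_unique_fixedPoint`, (1.14) = `bound_114`, the (1.4) instance `fixedPoint_115`, and the LOCATED IMPRECISION G-B13-02a: print's R2 `4C₂bε₂ ≦ 1`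
  gives the self-map only (`contraction_constant`: Lipschitz ≤ 9∕4); contractivity needs [15]'s «9C₂B₀ε₃ ≦ ½», absolute and k-free (`inspection_121_contraction`);
* ✓`B12Lineariz267`: the solution AS A FUNCTION `exists_Dt`, `norm_Dt_le`;
* ✓`B12LinearizAnalytic267`: Fréchet analyticity `differentiableOn_Dt` by the analytic implicit function theorem (`C` `AnalyticOnNhd`, both spaces complete).
Hence the rows of 𝔅 = `FHOps.Bounds` — (B-C) on `2ε₂`, (B-W) on `ε₂`, with R2, R3 — are print's SELF-MAP rows (faithful to p.5∕p.6) but not sufficient antecedents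
for `FH1Exists`∕`FH2Exists`; the sufficient antecedent is 𝔅⁺ = `BoundsC` (§B: same operator norms; `C`, `W` ANALYTIC with the quadratic bounds on FIXED radii
`R_C`, `R_W` — what B7 Prop 4∕7 and [15] Prop 4 deliver) with R2⁺ `9C₂bε₂ < 1`, `3ε₂ ≤ R_C`, R3⁺ `9C₄b²ε₃ < 1`, R4⁺ `3bε₃ ≤ R_W`.  §B `BoundsC.bounds : 𝔅⁺ → 𝔅`
(ADDITIVE: no name of the interface changes); §C `fh1Exists_of_boundsC`; §D `fh2Exists_of_boundsC` (the (1.4) fixed point as `exists_Dt`'s function of `A₁ = H₀B′`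
under `(C̃, h, ε, C₂) ↦ (−G∘W, −id, bε₃, C₄b)`, composed with the linear `H₀`); §E `fhClosed_of_boundsC`: 𝔅⁺ ∧ R2⁺ ∧ R3⁺ ∧ R4⁺ ∧ R4 ⟹ ∃ D A₀ solving (1.3),
(1.4) with (1.14), (1.16), and `hkFunctional O D A₀` = (1.17) analytic on `|B′| < ε₃` with (1.18) `‖H_k(B′)‖ ≤ 4b‖B′‖`; §E′ the s-decoupled edition
(`boundsC_fhOpsAt`, `fh12_on_sPolydisc`: F_H-1 ∧ F_H-2 at every `s` of the polydisc from (1.11)); §F a NONLINEAR one-dimensional model (`C z = C₂z²`) showing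
the hypothesis set of §E is inhabited with `C ≠ 0`.

REMARK (w9).  `DAnalyticBound` states (1.14) on the CLOSED ball `‖A′‖ ≤ ε₂`; §C meets it AS TYPED by extending `D` by `0` off the open ball (nothing consumes
`D` at `‖A′‖ = ε₂`: ✓`differentiableOn_hkFunctional` nests with `<`).  HONEST DELTA vs print: with `R_W = ε₂` R4⁺ reads `3bε₃ ≤ ε₂`, a factor-3∕2 tightening
of R4 `2bε₃ ≤ ε₂` — absolute, absorbed by p.7's inspection (status of G-B13-02a).

HONEST FRAMING.  Bookkeeping over an abstract interface: the INPUT rows of 𝔅⁺ at the record — (C-FW) = (1.11)∕[13] (3.107)–(3.108) for `H(s), H₀(s), G(s)` with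
`b = B₀e^{16κ₁}` uniformly on the polydisc, `C` = complex form of Proposition 4∕7 of B7 (GAPS G-B7-05∕G-B11-C1), `W = G̃(δ∕δA′)V` = (98) Proposition 4 [15]
on a complex background — are constructed NOWHERE in the tree at the port's records; analyticity IN `s` of the fixed points (leaf FH-s) is not asserted; F, S₃,
`stub_P0C` stay OPEN; ⟨27930⟩ 2∕7; NODE O 0∕1; nothing continuum∕OS∕Clay; the Yang–Mills mass gap is NOT proved.
-/

noncomputable section

open Metric Set

/-! ## §B  𝔅⁺ = `BoundsC` — the CONTRACTION-GRADE interface (what [15] (53)–(54) and the analytic implicit function theorem consume) -/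

namespace Summit.QuantumFields.YangMills.Theorems.BalabanUVNodesPortS1.FHDischarge

open Literature.MathematicalPhysics.QuantumFieldTheory.Balaban1983to89
open Literature.MathematicalPhysics.QuantumFieldTheory.Balaban1983to89.B13Contraction113 (QuadAnalytic)
open Summit.QuantumFields.YangMills.Theorems.BalabanUVNodesPortS1.FHInterface

variable {𝔄 𝔛 𝔅 𝔜 : Type*}
  [NormedAddCommGroup 𝔄] [NormedSpace ℂ 𝔄] [NormedAddCommGroup 𝔛] [NormedSpace ℂ 𝔛]
  [NormedAddCommGroup 𝔅] [NormedSpace ℂ 𝔅] [NormedAddCommGroup 𝔜] [NormedSpace ℂ 𝔜]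

/-- **𝔅⁺ — the contraction-grade interface.**  (B-op) as in 𝔅; (B-C)⁺ `C` complex-ANALYTIC on `‖Z‖ < R_C` with `‖C Z‖ ≤ C₂‖Z‖²` there
([15] p.285 «|C_j(…)| ≦ C₂(…)²» from Proposition 4∕7 of [4] = B7, on a FIXED radius — print's `c₄`-ball, not an `ε`-ball); (B-W)⁺ the same for
`W = G̃(δ∕δA′)V` with `C₄` on `‖Z‖ < R_W` ((98) Proposition 4 [15]).  The radii are consumed as `3ε₂ ≤ R_C` ((53) [15]: the Cauchy circle puts the
argument at `|Z| < 3ε`) and `3bε₃ ≤ R_W`; cf. ✓`B13Contraction113.lipschitz_T` (`hRC : 3 * ε ≤ R`).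
[cite: Balaban1985Variational, (44) p.285, (51)–(55) p.286] [cite: Balaban1988RG2Cluster, p.3 L1–5, (1.13)–(1.16) pp.5–6] -/
def BoundsC (O : FHOps 𝔄 𝔛 𝔅 𝔜) (b C₂ C₄ R_C R_W : ℝ) : Prop :=
  (‖O.H‖ ≤ b ∧ ‖O.H₀‖ ≤ b ∧ ‖O.G‖ ≤ b) ∧
  (AnalyticOnNhd ℂ O.C {Z : 𝔄 | ‖Z‖ < R_C} ∧ ∀ Z : 𝔄, ‖Z‖ < R_C → ‖O.C Z‖ ≤ C₂ * ‖Z‖ ^ 2) ∧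
  (AnalyticOnNhd ℂ O.W {Z : 𝔄 | ‖Z‖ < R_W} ∧ ∀ Z : 𝔄, ‖Z‖ < R_W → ‖O.W Z‖ ≤ C₄ * ‖Z‖ ^ 2)

/-- An analytic map with a quadratic bound on `‖Z‖ < R` is `QuadAnalytic` in the sense of ✓`B13Contraction113` (analytic along complex lines = the
chain rule with the affine line). [folklore] -/
theorem quadAnalytic_of_analyticOnNhd {E F : Type*} [NormedAddCommGroup E] [NormedSpace ℂ E] [NormedAddCommGroup F] [NormedSpace ℂ F]
    {C : E → F} {C₂ R : ℝ} (hCa : AnalyticOnNhd ℂ C {Z : E | ‖Z‖ < R})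
    (hq : ∀ Z : E, ‖Z‖ < R → ‖C Z‖ ≤ C₂ * ‖Z‖ ^ 2) : QuadAnalytic C C₂ R := by
  refine ⟨hq, fun P Q => ?_⟩
  have h1 : DifferentiableOn ℂ C {Z : E | ‖Z‖ < R} := hCa.differentiableOn
  have h2 : Differentiable ℂ (fun ζ : ℂ => P + ζ • Q) :=
    (differentiable_const P).add (differentiable_id.smul_const Q)
  exact h1.comp h2.differentiableOn (fun ζ hζ => hζ)

/-- **𝔅⁺ refines 𝔅** (the interface of record is untouched; 𝔅⁺ is ADDITIVE): for `2ε₂ ≤ R_C`, `ε₂ ≤ R_W` the self-map rows of `FHOps.Bounds` follow.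
[folklore] -/
theorem BoundsC.bounds {O : FHOps 𝔄 𝔛 𝔅 𝔜} {b C₂ C₄ R_C R_W ε₂ : ℝ} (h : BoundsC O b C₂ C₄ R_C R_W)
    (hC : 2 * ε₂ ≤ R_C) (hW : ε₂ ≤ R_W) : O.Bounds b C₂ C₄ ε₂ := by
  obtain ⟨hop, ⟨hCa, hCq⟩, ⟨hWa, hWq⟩⟩ := h
  have h1 : DifferentiableOn ℂ O.C (Metric.ball 0 (2 * ε₂)) :=
    hCa.differentiableOn.mono (fun Z hZ => by
      rw [Metric.mem_ball, dist_zero_right] at hZ; exact hZ.trans_le hC)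
  have h2 : DifferentiableOn ℂ O.W (Metric.ball 0 ε₂) :=
    hWa.differentiableOn.mono (fun Z hZ => by
      rw [Metric.mem_ball, dist_zero_right] at hZ; exact hZ.trans_le hW)
  unfold FHOps.Bounds
  exact ⟨hop, ⟨h1, fun Z hZ => hCq Z (hZ.trans_le hC)⟩, ⟨h2, fun Z hZ => hWq Z (hZ.trans_le hW)⟩⟩

/-- The printed restrictions follow from the contraction-grade ones (R2 from R2⁺, R3 from R3⁺) — cf. ✓`B13Contraction113.contraction_constant`.
Real arithmetic. [cite: Balaban1985Variational, p.286 after (54)] -/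
theorem selfMap_of_contraction {C₂ C₄ b ε₂ ε₃ : ℝ} (hq₂ : 9 * C₂ * b * ε₂ < 1) (hq₃ : 9 * C₄ * b ^ 2 * ε₃ < 1) :
    4 * C₂ * b * ε₂ ≤ 1 ∧ 4 * C₄ * b ^ 2 * ε₃ ≤ 1 := by
  constructor <;> linarith

/-! ## §C  F_H-1 DISCHARGED: `FH1Exists` from 𝔅⁺, R2⁺ `9C₂bε₂ < 1`, `3ε₂ ≤ R_C` — by name from ✓`B12Lineariz267` + ✓`B12LinearizAnalytic267` -/

/-- **F_H-1 is a theorem over 𝔅⁺.**  Existence of `D` solving (1.3) on `|A′| < ε₂` = ✓`B12Lineariz267.exists_Dt` (the contraction mapping theorem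
of ✓`B13Contraction113.exists_unique_fixedPoint`, [15] Sect. C transplanted — [II] p.5 «We prove similarly that it is contractive»); (1.14) =
✓`B12Lineariz267.norm_Dt_le` (= ✓`bound_114`, print's «ε₂ arbitrarily close to |A′|»); Fréchet analyticity on the open ball =
✓`B12LinearizAnalytic267.differentiableOn_Dt` (analytic implicit function theorem).  `D` is extended by `0` off the open ball to meet `DAnalyticBound`'s
closed-ball clause AS TYPED (remark w9). [cite: Balaban1988RG2Cluster, (1.13)–(1.14) p.5] [cite: Balaban1985Variational, (53)–(55) p.286] -/
theorem fh1Exists_of_boundsC [CompleteSpace 𝔄] [CompleteSpace 𝔛] (O : FHOps 𝔄 𝔛 𝔅 𝔜) {b C₂ C₄ R_C R_W ε₂ : ℝ}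
    (hC₂ : 0 ≤ C₂) (hb : 0 ≤ b) (h𝔅 : BoundsC O b C₂ C₄ R_C R_W)
    (hq : 9 * C₂ * b * ε₂ < 1) (hR : 3 * ε₂ ≤ R_C) : FH1Exists O ε₂ C₂ := by
  classical
  obtain ⟨⟨hH, -, -⟩, ⟨hCa, hCq⟩, -⟩ := h𝔅
  have hQA : QuadAnalytic O.C C₂ R_C := quadAnalytic_of_analyticOnNhd hCa hCq
  have hHop : ∀ X : 𝔛, ‖(O.H : 𝔛 →ₗ[ℂ] 𝔄) X‖ ≤ b * ‖X‖ := fun X =>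
    (O.H.le_opNorm X).trans (mul_le_mul_of_nonneg_right hH (norm_nonneg _))
  obtain ⟨Dt, hDt⟩ := B12Lineariz267.exists_Dt (hop := (O.H : 𝔛 →ₗ[ℂ] 𝔄)) hQA hC₂ hb hHop hq hR
  have hDball : ∀ A' : 𝔄, ‖A'‖ < ε₂ → Dt A' ∈ closedBall (0:𝔛) (4 * C₂ * ε₂ ^ 2) := fun A' h => (hDt A' h).1
  have hDfix : ∀ A' : 𝔄, ‖A'‖ < ε₂ → O.C (A' - (O.H : 𝔛 →ₗ[ℂ] 𝔄) (Dt A')) = Dt A' := fun A' h => (hDt A' h).2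
  have hDd : DifferentiableOn ℂ Dt (ball (0:𝔄) ε₂) :=
    B12LinearizAnalytic267.differentiableOn_Dt hQA hCa hC₂ hb hHop hq hR hDball hDfix
  -- the solution of record: `Dt` on the open ball, `0` elsewhere
  refine ⟨fun A' => if ‖A'‖ < ε₂ then Dt A' else 0, ?_, ?_, ?_⟩
  · intro A' hA'
    simp only [if_pos hA']
    exact (hDfix A' hA').symm
  · refine hDd.congr ?_
    intro A' hA'
    rw [Metric.mem_ball, dist_zero_right] at hA'
    simp only [if_pos hA']
  · intro A' hA'
    by_cases h : ‖A'‖ < ε₂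
    · simp only [if_pos h]
      exact B12Lineariz267.norm_Dt_le hQA hC₂ hb hHop hq hR hDball hDfix h
    · simp only [if_neg h, norm_zero]
      positivity

/-! ## §D  F_H-2 DISCHARGED: `FH2Exists` from 𝔅⁺, R3⁺ `9C₄b²ε₃ < 1`, `3bε₃ ≤ R_W` — the scheme of ✓`B13Contraction113.fixedPoint_115` as a FUNCTION of `B′` -/

/-- The (1.4) map in fixed-point form, `Y ↦ −G(W Y)` (so that (1.4) reads `A₀ = C̃(A₁ + A₀)`, `A₁ = H₀B′` — ✓`fixedPoint_115`'s substitution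
`(C₂, b, ε, H) ↦ (C₄b, 1, bε₃, −id)`). [cite: Balaban1988RG2Cluster, (1.4) p.2, (1.15) p.6] -/
def ctW (O : FHOps 𝔄 𝔛 𝔅 𝔜) : 𝔄 → 𝔄 := fun Y => -(O.G (O.W Y))

/-- Unfolding `ctW` (bookkeeping). [cite: Balaban1988RG2Cluster, (1.4) p.2 (bookkeeping)] -/
@[simp] theorem ctW_apply (O : FHOps 𝔄 𝔛 𝔅 𝔜) (Y : 𝔄) : ctW O Y = -(O.G (O.W Y)) := rfl

/-- `−G∘W` has quadratic constant `C₄b` on `‖Y‖ < R_W` and is analytic there. [cite: Balaban1988RG2Cluster, (1.15) p.6] -/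
theorem quadAnalytic_ctW {O : FHOps 𝔄 𝔛 𝔅 𝔜} {b C₄ R_W : ℝ} (hb : 0 ≤ b) (hG : ‖O.G‖ ≤ b)
    (hWa : AnalyticOnNhd ℂ O.W {Z : 𝔄 | ‖Z‖ < R_W}) (hWq : ∀ Z : 𝔄, ‖Z‖ < R_W → ‖O.W Z‖ ≤ C₄ * ‖Z‖ ^ 2) :
    AnalyticOnNhd ℂ (ctW O) {Z : 𝔄 | ‖Z‖ < R_W} ∧ QuadAnalytic (ctW O) (C₄ * b) R_W := by
  have hCta : AnalyticOnNhd ℂ (ctW O) {Z : 𝔄 | ‖Z‖ < R_W} := by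
    intro Y hY
    show AnalyticAt ℂ (fun Y => -(O.G (O.W Y))) Y
    exact ((O.G.analyticAt (O.W Y)).comp (hWa Y hY)).neg
  have hCtq : ∀ Y : 𝔄, ‖Y‖ < R_W → ‖ctW O Y‖ ≤ C₄ * b * ‖Y‖ ^ 2 := by
    intro Y hY
    calc ‖ctW O Y‖ = ‖O.G (O.W Y)‖ := by rw [ctW_apply, norm_neg]
      _ ≤ ‖O.G‖ * ‖O.W Y‖ := O.G.le_opNorm _
      _ ≤ b * (C₄ * ‖Y‖ ^ 2) := mul_le_mul hG (hWq Y hY) (norm_nonneg _) hb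
      _ = C₄ * b * ‖Y‖ ^ 2 := by ring
  exact ⟨hCta, quadAnalytic_of_analyticOnNhd hCta hCtq⟩

/-- **F_H-2 is a theorem over 𝔅⁺.**  The solution `A₀(B′)` of (1.4) on `|B′| < ε₃` is `D̃(H₀B′)` where `D̃` is ✓`B12Lineariz267.exists_Dt`'s function
for `(C̃, h, ε, C₂) := (−G∘W, −id, bε₃, C₄b)` on `‖A₁‖ < bε₃` (print p.6: «The norm of the function H₀(s(Y₀))B′ + 𝐀 is bounded by B₀e^{16κ₁}ε₃ +
4C₄(B₀e^{16κ₁})³ε₃² ≦ 2B₀e^{16κ₁}ε₃»); (1.16) `‖A₀(B′)‖ ≤ 4C₄b³‖B′‖²` = ✓`norm_Dt_le` with `‖H₀B′‖ ≤ b‖B′‖` (exactly ✓`fixedPoint_115`'s last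
`calc`); analyticity = ✓`B12LinearizAnalytic267.differentiableOn_Dt` composed with the linear `H₀`.  Restrictions: R3⁺ `9C₄b²ε₃ < 1` (the
undisplayed contraction condition behind (1.15), G-B13-02a) and `3bε₃ ≤ R_W`. [cite: Balaban1988RG2Cluster, (1.15)–(1.16) p.6]
[cite: Balaban1985Variational, (116)–(121) p.295] -/
theorem fh2Exists_of_boundsC [CompleteSpace 𝔄] (O : FHOps 𝔄 𝔛 𝔅 𝔜) {b C₂ C₄ R_C R_W ε₃ : ℝ}
    (hC₄ : 0 ≤ C₄) (hb : 0 < b) (h𝔅 : BoundsC O b C₂ C₄ R_C R_W)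
    (hq : 9 * C₄ * b ^ 2 * ε₃ < 1) (hR : 3 * (b * ε₃) ≤ R_W) : FH2Exists O ε₃ C₄ b := by
  classical
  obtain ⟨⟨-, hH₀, hG⟩, -, ⟨hWa, hWq⟩⟩ := h𝔅
  obtain ⟨hCta, hQA⟩ := quadAnalytic_ctW hb.le hG hWa hWq
  have hC₂ : 0 ≤ C₄ * b := mul_nonneg hC₄ hb.le
  have hHop : ∀ X : 𝔄, ‖(-LinearMap.id : 𝔄 →ₗ[ℂ] 𝔄) X‖ ≤ 1 * ‖X‖ := fun X => by simp
  have hq' : 9 * (C₄ * b) * 1 * (b * ε₃) < 1 := by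
    have e : 9 * (C₄ * b) * 1 * (b * ε₃) = 9 * C₄ * b ^ 2 * ε₃ := by ring
    rw [e]; exact hq
  obtain ⟨Dt, hDt⟩ := B12Lineariz267.exists_Dt (hop := (-LinearMap.id : 𝔄 →ₗ[ℂ] 𝔄)) hQA hC₂ zero_le_one hHop hq' hR
  have hDball : ∀ Y : 𝔄, ‖Y‖ < b * ε₃ → Dt Y ∈ closedBall (0:𝔄) (4 * (C₄ * b) * (b * ε₃) ^ 2) :=
    fun Y h => (hDt Y h).1
  have hDfix : ∀ Y : 𝔄, ‖Y‖ < b * ε₃ → ctW O (Y - (-LinearMap.id : 𝔄 →ₗ[ℂ] 𝔄) (Dt Y)) = Dt Y :=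
    fun Y h => (hDt Y h).2
  have hDd : DifferentiableOn ℂ Dt (ball (0:𝔄) (b * ε₃)) :=
    B12LinearizAnalytic267.differentiableOn_Dt hQA hCta hC₂ zero_le_one hHop hq' hR hDball hDfix
  -- `A₁ = H₀B′` lies in the ball `bε₃` for `|B′| < ε₃`
  have hH₀B' : ∀ B' : 𝔅, ‖O.H₀ B'‖ ≤ b * ‖B'‖ := fun B' =>
    (O.H₀.le_opNorm B').trans (mul_le_mul_of_nonneg_right hH₀ (norm_nonneg _))
  have hH₀B : ∀ B' : 𝔅, ‖B'‖ < ε₃ → ‖O.H₀ B'‖ < b * ε₃ := fun B' hB' =>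
    (hH₀B' B').trans_lt (mul_lt_mul_of_pos_left hB' hb)
  refine ⟨fun B' => Dt (O.H₀ B'), ?_, ?_, ?_⟩
  · -- (1.4): `A₀(B′) + G W(H₀B′ + A₀(B′)) = 0`
    intro B' hB'
    have key : -(O.G (O.W (O.H₀ B' + Dt (O.H₀ B')))) = Dt (O.H₀ B') := by
      simpa [sub_neg_eq_add] using hDfix (O.H₀ B') (hH₀B B' hB')
    show Dt (O.H₀ B') + O.G (O.W (O.H₀ B' + Dt (O.H₀ B'))) = 0
    calc Dt (O.H₀ B') + O.G (O.W (O.H₀ B' + Dt (O.H₀ B')))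
        = -(O.G (O.W (O.H₀ B' + Dt (O.H₀ B')))) + O.G (O.W (O.H₀ B' + Dt (O.H₀ B'))) := by rw [key]
      _ = 0 := neg_add_cancel _
  · -- analyticity on `|B′| < ε₃`: `D̃ ∘ H₀`
    exact hDd.comp O.H₀.differentiable.differentiableOn (fun B' hB' => by
      rw [Metric.mem_ball, dist_zero_right] at hB' ⊢
      exact hH₀B B' hB')
  · -- (1.16)
    intro B' hB'
    show ‖Dt (O.H₀ B')‖ ≤ 4 * C₄ * b ^ 3 * ‖B'‖ ^ 2
    calc ‖Dt (O.H₀ B')‖ ≤ 4 * (C₄ * b) * ‖O.H₀ B'‖ ^ 2 :=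
          B12Lineariz267.norm_Dt_le hQA hC₂ zero_le_one hHop hq' hR hDball hDfix (hH₀B B' hB')
      _ ≤ 4 * (C₄ * b) * (b * ‖B'‖) ^ 2 := by
          gcongr
          exact hH₀B' B'
      _ = 4 * C₄ * b ^ 3 * ‖B'‖ ^ 2 := by ring

/-! ## §E  THE F_H NODE CLOSED OVER 𝔅⁺: (1.3)–(1.4) solved, (1.14)–(1.16), and `H_k` of (1.17) analytic with (1.18) -/

/-- **F_H over 𝔅⁺ — the package.**  Under 𝔅⁺, R2⁺ `9C₂bε₂ < 1`, `3ε₂ ≤ R_C`, R3⁺ `9C₄b²ε₃ < 1`, `3bε₃ ≤ R_W` and the printed nesting R4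
`2bε₃ ≤ ε₂`: THE solutions `D` of (1.3) and `A₀` of (1.4) exist on their balls with (1.14)∕(1.16) and are analytic, and the functional
`H_k(B′) = H₀B′ + A₀(B′) − H D(H₀B′ + A₀(B′))` of (1.17)∕(1.2) is analytic on `|B′| < ε₃` with `‖H_k(B′)‖ ≤ 4b‖B′‖` (1.18).  §C + §D + the
interface's own ✓`differentiableOn_hkFunctional`∕✓`norm_hkFunctional_le` (R2, R3 from R2⁺, R3⁺ by `selfMap_of_contraction`).  This is print's
«It is an analytic function of s(Y₀), B′, satisfying the bound |H_k(s(Y₀), B′)| ≦ 4B₀e^{16κ₁}|B′|» for ONE operator triple — at the record, for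
every `s` in the polydisc via `DecoupledOps.bounds_fhOpsAt` once (C-FW) supplies 𝔅⁺ uniformly. [cite: Balaban1988RG2Cluster, (1.17)–(1.18) p.6] -/
theorem fhClosed_of_boundsC [CompleteSpace 𝔄] [CompleteSpace 𝔛] (O : FHOps 𝔄 𝔛 𝔅 𝔜) {b C₂ C₄ R_C R_W ε₂ ε₃ : ℝ}
    (hC₂ : 0 ≤ C₂) (hC₄ : 0 ≤ C₄) (hb : 0 < b) (h𝔅 : BoundsC O b C₂ C₄ R_C R_W)
    (hq₂ : 9 * C₂ * b * ε₂ < 1) (hRC : 3 * ε₂ ≤ R_C) (hq₃ : 9 * C₄ * b ^ 2 * ε₃ < 1) (hRW : 3 * (b * ε₃) ≤ R_W)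
    (hR4 : 2 * b * ε₃ ≤ ε₂) :
    ∃ (D : 𝔄 → 𝔛) (A₀ : 𝔅 → 𝔄), DSolves O ε₂ D ∧ DAnalyticBound ε₂ C₂ D ∧ A0Solves O ε₃ A₀ ∧ A0AnalyticBound ε₃ C₄ b A₀ ∧
      DifferentiableOn ℂ (hkFunctional O D A₀) (Metric.ball 0 ε₃) ∧
      ∀ B' : 𝔅, ‖B'‖ < ε₃ → ‖hkFunctional O D A₀ B'‖ ≤ 4 * b * ‖B'‖ := by
  obtain ⟨D, hDs, hDa⟩ := fh1Exists_of_boundsC O hC₂ hb.le h𝔅 hq₂ hRC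
  obtain ⟨A₀, hAs, hAa⟩ := fh2Exists_of_boundsC O hC₄ hb h𝔅 hq₃ hRW
  obtain ⟨hR2, hR3⟩ := selfMap_of_contraction hq₂ hq₃
  obtain ⟨⟨hH, hH₀, -⟩, -, -⟩ := h𝔅
  exact ⟨D, A₀, hDs, hDa, hAs, hAa,
    differentiableOn_hkFunctional O hC₄ hb hR3 hR4 hH₀ hDa.1 hAa.1 hAa.2,
    fun B' hB => norm_hkFunctional_le O hC₂ hC₄ hb.le hR2 hR3 hR4 hH hH₀ hDa.2 hAa.2 B' hB⟩

/-- Use-form: F_H-1 ∧ F_H-2 ∧ F_H-3 of the interface of record, from 𝔅⁺. [cite: Balaban1988RG2Cluster, (1.13)–(1.18) pp.5–6] -/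
theorem fh123_of_boundsC [CompleteSpace 𝔄] [CompleteSpace 𝔛] (O : FHOps 𝔄 𝔛 𝔅 𝔜) {b C₂ C₄ R_C R_W ε₂ ε₃ : ℝ}
    (hC₂ : 0 ≤ C₂) (hC₄ : 0 ≤ C₄) (hb : 0 < b) (h𝔅 : BoundsC O b C₂ C₄ R_C R_W)
    (hq₂ : 9 * C₂ * b * ε₂ < 1) (hRC : 3 * ε₂ ≤ R_C) (hq₃ : 9 * C₄ * b ^ 2 * ε₃ < 1) (hRW : 3 * (b * ε₃) ≤ R_W) :
    FH1Exists O ε₂ C₂ ∧ FH2Exists O ε₃ C₄ b :=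
  ⟨fh1Exists_of_boundsC O hC₂ hb.le h𝔅 hq₂ hRC, fh2Exists_of_boundsC O hC₄ hb h𝔅 hq₃ hRW⟩

/-! ## §E′  The s-decoupled edition: 𝔅⁺ at every `s` of the polydisc, hence F_H-1 ∧ F_H-2 there (record-edition SHAPE; the instance is (C-FW)'s business) -/

/-- **At every `s` of the sPolydisc the decoupled data instantiate 𝔅⁺** with `b = B₀e^{16κ₁}`, given (B-C)⁺∕(B-W)⁺ for the (s-independent) `C`, `W` — the
contraction-grade twin of ✓`DecoupledOps.bounds_fhOpsAt` (bookkeeping). [cite: Balaban1988RG2Cluster, p.3 L1–5, (1.11) p.5] -/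
theorem boundsC_fhOpsAt {σ : Type*} [Fintype σ] (fam : DecoupledOps 𝔄 𝔛 𝔅 𝔜 σ) {κ₁ B₀ C₂ C₄ R_C R_W : ℝ}
    (hfam : fam.Bounds κ₁ B₀) {C : 𝔄 → 𝔛} {W : 𝔄 → 𝔜}
    (hC : AnalyticOnNhd ℂ C {Z : 𝔄 | ‖Z‖ < R_C} ∧ ∀ Z : 𝔄, ‖Z‖ < R_C → ‖C Z‖ ≤ C₂ * ‖Z‖ ^ 2)
    (hW : AnalyticOnNhd ℂ W {Z : 𝔄 | ‖Z‖ < R_W} ∧ ∀ Z : 𝔄, ‖Z‖ < R_W → ‖W Z‖ ≤ C₄ * ‖Z‖ ^ 2)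
    {s : σ → ℂ} (hs : s ∈ sPolydisc σ (Real.exp κ₁)) :
    BoundsC (fam.fhOpsAt C W s) (B₀ * Real.exp (16 * κ₁)) C₂ C₄ R_C R_W := by
  obtain ⟨⟨_, hH⟩, ⟨_, hH₀⟩, ⟨_, hG⟩⟩ := hfam
  unfold BoundsC DecoupledOps.fhOpsAt
  exact ⟨⟨hH s hs, hH₀ s hs, hG s hs⟩, hC, hW⟩

/-- **F_H-1 ∧ F_H-2 at every `s` of the polydisc** («It is an analytic function of … B′» for each fixed `s`; analyticity IN `s` of the fixed points is NOT
asserted here — leaf FH-s of the cover memo), from (1.11) = `DecoupledOps.Bounds`, (B-C)⁺, (B-W)⁺ and the contraction-grade restrictions with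
`b = B₀e^{16κ₁}`. [cite: Balaban1988RG2Cluster, (1.11)–(1.16) pp.5–6] -/
theorem fh12_on_sPolydisc [CompleteSpace 𝔄] [CompleteSpace 𝔛] {σ : Type*} [Fintype σ] (fam : DecoupledOps 𝔄 𝔛 𝔅 𝔜 σ)
    {κ₁ B₀ C₂ C₄ R_C R_W ε₂ ε₃ : ℝ} (hC₂ : 0 ≤ C₂) (hC₄ : 0 ≤ C₄) (hb : 0 < B₀ * Real.exp (16 * κ₁))
    (hfam : fam.Bounds κ₁ B₀) {C : 𝔄 → 𝔛} {W : 𝔄 → 𝔜}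
    (hC : AnalyticOnNhd ℂ C {Z : 𝔄 | ‖Z‖ < R_C} ∧ ∀ Z : 𝔄, ‖Z‖ < R_C → ‖C Z‖ ≤ C₂ * ‖Z‖ ^ 2)
    (hW : AnalyticOnNhd ℂ W {Z : 𝔄 | ‖Z‖ < R_W} ∧ ∀ Z : 𝔄, ‖Z‖ < R_W → ‖W Z‖ ≤ C₄ * ‖Z‖ ^ 2)
    (hq₂ : 9 * C₂ * (B₀ * Real.exp (16 * κ₁)) * ε₂ < 1) (hRC : 3 * ε₂ ≤ R_C)
    (hq₃ : 9 * C₄ * (B₀ * Real.exp (16 * κ₁)) ^ 2 * ε₃ < 1) (hRW : 3 * ((B₀ * Real.exp (16 * κ₁)) * ε₃) ≤ R_W)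
    {s : σ → ℂ} (hs : s ∈ sPolydisc σ (Real.exp κ₁)) :
    FH1Exists (fam.fhOpsAt C W s) ε₂ C₂ ∧ FH2Exists (fam.fhOpsAt C W s) ε₃ C₄ (B₀ * Real.exp (16 * κ₁)) :=
  fh123_of_boundsC (fam.fhOpsAt C W s) hC₂ hC₄ hb (boundsC_fhOpsAt fam hfam hC hW hs) hq₂ hRC hq₃ hRW

/-! ## §F  NON-VACUITY WITH A NONLINEAR `C`: the one-dimensional model `C z = C₂z²`, `W z = C₄z²`, `H = H₀ = G = b·1` on ℂ -/

/-- The one-dimensional model of the data. [folklore] -/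
def model (b C₂ C₄ : ℝ) : FHOps ℂ ℂ ℂ ℂ :=
  ⟨(b : ℂ) • ContinuousLinearMap.id ℂ ℂ, (b : ℂ) • ContinuousLinearMap.id ℂ ℂ, (b : ℂ) • ContinuousLinearMap.id ℂ ℂ,
    fun z : ℂ => (C₂ : ℂ) * z ^ 2, fun z : ℂ => (C₄ : ℂ) * z ^ 2⟩

/-- `‖b·1‖ ≤ b` on ℂ (bookkeeping for the model). [folklore] -/
theorem norm_realSmul_id_le {b : ℝ} (hb : 0 ≤ b) : ‖(b : ℂ) • ContinuousLinearMap.id ℂ ℂ‖ ≤ b := by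
  rw [norm_smul, ContinuousLinearMap.norm_id, mul_one, Complex.norm_real, Real.norm_of_nonneg hb]

/-- `z ↦ c z²` is entire (bookkeeping for the model). [folklore] -/
theorem analyticOnNhd_sq (c : ℝ) (R : ℝ) : AnalyticOnNhd ℂ (fun z : ℂ => (c : ℂ) * z ^ 2) {Z : ℂ | ‖Z‖ < R} :=
  fun _ _ => analyticAt_const.mul ((analyticAt_id).pow 2)

/-- `‖c z²‖ = c‖z‖²` for `c ≥ 0` (bookkeeping for the model). [folklore] -/
theorem norm_sq_le {c : ℝ} (hc : 0 ≤ c) (R : ℝ) : ∀ Z : ℂ, ‖Z‖ < R → ‖(c : ℂ) * Z ^ 2‖ ≤ c * ‖Z‖ ^ 2 := by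
  intro Z _
  rw [norm_mul, norm_pow, Complex.norm_real, Real.norm_of_nonneg hc]

/-- The model satisfies 𝔅⁺ for every `R_C`, `R_W` (its `C`, `W` are entire). [folklore] -/
theorem boundsC_model {b C₂ C₄ : ℝ} (hb : 0 ≤ b) (hC₂ : 0 ≤ C₂) (hC₄ : 0 ≤ C₄) (R_C R_W : ℝ) :
    BoundsC (model b C₂ C₄) b C₂ C₄ R_C R_W := by
  unfold BoundsC model
  exact ⟨⟨norm_realSmul_id_le hb, norm_realSmul_id_le hb, norm_realSmul_id_le hb⟩,
    ⟨analyticOnNhd_sq C₂ R_C, norm_sq_le hC₂ R_C⟩, ⟨analyticOnNhd_sq C₄ R_W, norm_sq_le hC₄ R_W⟩⟩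

/-- **Non-vacuity of §C–§E with a NONLINEAR `C`**: `b = 1`, `C₂ = C₄ = 1∕16`, `ε₂ = 1∕2`, `ε₃ = 1∕4`, `R_C = 2`, `R_W = 1` meet R2⁺ (`9∕32 < 1`),
`3ε₂ ≤ R_C`, R3⁺ (`9∕64 < 1`), `3bε₃ ≤ R_W`, R4 (`1∕2 ≤ 1∕2`); the package applies and produces the (nonzero) solution `D` of `D = (A′ − D)²∕16`.
[folklore] -/
example : ∃ (D : ℂ → ℂ) (A₀ : ℂ → ℂ), DSolves (model 1 (1/16) (1/16)) (1/2) D ∧ DAnalyticBound (1/2) (1/16) D ∧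
    A0Solves (model 1 (1/16) (1/16)) (1/4) A₀ ∧ A0AnalyticBound (1/4) (1/16) 1 A₀ ∧
    DifferentiableOn ℂ (hkFunctional (model 1 (1/16) (1/16)) D A₀) (Metric.ball 0 (1/4)) ∧
    ∀ B' : ℂ, ‖B'‖ < 1/4 → ‖hkFunctional (model 1 (1/16) (1/16)) D A₀ B'‖ ≤ 4 * 1 * ‖B'‖ :=
  fhClosed_of_boundsC (model 1 (1/16) (1/16)) (by norm_num) (by norm_num) one_pos
    (boundsC_model zero_le_one (by norm_num) (by norm_num) 2 1)
    (by norm_num) (by norm_num) (by norm_num) (by norm_num) (by norm_num)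

end Summit.QuantumFields.YangMills.Theorems.BalabanUVNodesPortS1.FHDischarge

end
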